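import Summits.NavierStokesRegularity.NavierStokesRegularity.Theorems.EpisodeBase.Negative.FirstEpisodeRFalse

/-!
# Crux `EpisodeBase`, negative lane: the registered line's stub statement is false AT THE LETTER

Cell `ns-blowup`, seat `ns-blowup-refuter4` (g4; route refuter of `PalasekTowerBreakdown`), item
stmt-NavierStokesRegularity-19179 `EpisodeBase`. LABEL: E–C typing (KERNEL negative-lane corollary,
hypothesis-free). WHAT THIS IS NOT: not Navier–Stokes evidence and NOT `¬EpisodeBaseG` — the ∃-crux over
DESIGNED hosts is untouched; nothing about regularity or blow-up.

## What is here, and why it is not already `EpisodeBaseNegative.not_firstEpisodeR`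

`EpisodeBaseNegative.not_firstEpisodeR` (ecbridge-4 g4, `FirstEpisodeRFalse.lean`) refutes the FluidComputer
placeholder `PalasekTowerClayBridge.FirstEpisodeR` (`PalasekTowerRegisterGlobalBase.lean`), whose final clause
asks the level-`1` stage to agree with the host in velocity AND pressure on `[0, τ 0]`
(`s₁.u t = s₀.u t ∧ s₁.p t = s₀.p t`). The stub actually REGISTERED on the crux's line
`Cruxes/EpisodeBase/Lines/birth.lean` (844b516), `BirthEpisodeBaseG.stub_first_episodeR`, asserts a LOCAL
declaration `BirthEpisodeBaseG.FirstEpisodeR` whose final clause is velocity-only (`s₁.u t = s₀.u t`). Its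
`∃`-body is therefore WEAKER, so `¬ PalasekTowerClayBridge.FirstEpisodeR` does not imply its negation
formally. This file closes that gap with the statement the line's bookkeeping needs:

* `not_firstEpisodeR_velocityAgree` — the velocity-only re-forcing placeholder (verbatim the body of
  `BirthEpisodeBaseG.FirstEpisodeR`, with the route margin `Margins.routeG TowerRates.wide` for its `abbrev mG`)
  is false. Same witness and same proof as `not_firstEpisodeR` (the pressure clause was never used): the tiny
  anchored host `U_a` (`TinyBlob.levelZeroDataWeak … .exists_host`, radius `2a`,
  `‖U_a‖₂ ≤ Y₀ (8a³|B̄₁|)^{1/2}`) re-forced by ANY admissible push has radius and host energy below the `δ` of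
  `EpisodeBaseNegative.stageOne_energy_floor`, so no level-`1` stage of the re-forced schedule has the host's
  velocity at `τ 0`.
* `not_firstEpisodeR_noAgree` — the still weaker form with the host's slice pinned only AT `τ 0`
  (`s₁.u (τ 0) = s₀.u (τ 0)`) and no quietness asked of the re-forced schedule is what the argument really
  kills; the registered stub's statement and the FluidComputer placeholder (whose pressure clause is idle) are
  both instances.

Consequence for the line (planner / lead, not a verdict on the item): the registered skeleton's only active
stub is false outright; the line must be re-registered on the exact-class split
`HostPreparationD (HostClass.exact S⋆) ∧ FirstEpisodeD (HostClass.exact S⋆)`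
(`Theorems/PalasekTowerBreakdownEpisodeBaseHost.lean`).

References: T. Tao, *Localisation and compactness properties of the Navier–Stokes global regularity
problem*, Anal. PDE 6 (2013), Lemma 8.1 [cite: Tao2011, Lemma 8.1 (arXiv Lemma 44)]; S. Palasek,
arXiv:2605.13827 §3.3 [cite: Palasek2026ElementaryModel, §3.3].
-/

noncomputable section

namespace Summit.NavierStokesRegularity.EpisodeBaseNegative

open Set MeasureTheory Filter Topology Function Real Metric
open scoped ENNReal ContDiff NNReal

open Literature.Analysis.FluidPDE
open Summit.NavierStokesRegularity.FluidComputer.PalasekTowerClayBridge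

/-! ## §1 Small tool (folklore; private in `FirstEpisodeRFalse.lean`, exported here) -/

/-- **`L²` size of a bounded confined field**: `‖h‖ ≤ B` everywhere and `h = 0` off `B̄(0, ρ)` give
`‖h‖₂ ≤ B (ρ³ |B̄₁|)^{1/2}`. [folklore] -/
theorem eLpNorm_two_le_of_bound_of_confined
    {h : EuclideanSpace ℝ (Fin 3) → EuclideanSpace ℝ (Fin 3)}
    {B ρ : ℝ} (hρ : 0 ≤ ρ) (hbd : ∀ y, ‖h y‖ ≤ B)
    (hconf : ∀ y, ρ < ‖y‖ → h y = 0) :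
    eLpNorm h 2 volume ≤ ENNReal.ofReal (B * Real.sqrt (ρ ^ 3 * TinyBlob.unitBallVol)) := by
  have hsupp : support h ⊆ closedBall (0 : EuclideanSpace ℝ (Fin 3)) ρ := by
    intro y hy
    rw [mem_closedBall, dist_zero_right]
    by_contra hlt
    exact hy (hconf y (not_le.1 hlt))
  rw [← eLpNorm_restrict_eq_of_support_subset hsupp]
  have hb : ∀ᵐ y ∂(volume.restrict (closedBall (0 : EuclideanSpace ℝ (Fin 3)) ρ)), ‖h y‖ ≤ B :=
    Eventually.of_forall fun y => hbd y
  refine (eLpNorm_le_of_ae_bound hb).trans (le_of_eq ?_)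
  have hv := TinyBlob.unitBallVol_nonneg
  rw [Measure.restrict_apply_univ, Measure.addHaar_closedBall' volume _ hρ,
    finrank_euclideanSpace, Fintype.card_fin, TinyBlob.volume_closedBall_one,
    ← ENNReal.ofReal_mul (by positivity), ENNReal.toReal_ofNat,
    ENNReal.ofReal_rpow_of_nonneg (by positivity) (by norm_num),
    ← ENNReal.ofReal_mul (by positivity), Real.sqrt_eq_rpow]
  congr 1
  rw [show ((2 : ℝ)⁻¹) = (1 / 2 : ℝ) by norm_num]
  ring

/-! ## §2 The placeholder is false with the slice pinned only at `τ 0` -/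

/-- **No admissible re-forcing of every host carries a level-`1` stage through the host's slice.** The
weakest re-forcing placeholder — for every pinned rigid quiet wide schedule and every registered level-`0`
host `s₀`, SOME admissible window force `g` (Clay class, silent from `T`, `push_small`, equal to `S.f` on
`[0, τ 0]`) re-forces `S` to a pinned rigid schedule carrying a level-`1` stage `s₁` with
`s₁.u (τ 0) = s₀.u (τ 0)` — is false: the tiny anchored host of radius `2a` has slice energy
`≤ Y₀ (8a³|B̄₁|)^{1/2}`, below the energy floor `EpisodeBaseNegative.stageOne_energy_floor` of every level-`1`
stage of a schedule of radius `≤ δ`, for `a` small. (Quietness of the re-forced schedule is not even asked.)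
[cite: Tao2011, Lemma 8.1 (arXiv Lemma 44)] -/
theorem not_firstEpisodeR_noAgree :
    ¬ (∀ S : Schedule TowerRates.wide, S.Pins 8 (6 / 5) → S.Rigid → S.Quiet →
        ∀ s₀ : Stage 1 TowerRates.wide S (Margins.routeG TowerRates.wide) 0,
          ∃ (g : ℝ → EuclideanSpace ℝ (Fin 3) → EuclideanSpace ℝ (Fin 3))
            (h₁ : IsSmoothOnHalfSpace g) (h₂ : HasRapidSpaceTimeDecay g)
            (h₃ : ∀ t, S.T ≤ t → ∀ x, g t x = 0)
            (h₄ : ∀ k, ∀ t ∈ Icc (S.τ k) (S.τ (k + 1)), ∀ x, ‖g t x‖ ≤ S.c₄ * TowerRates.wide.Y k),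
            (S.reforce g h₁ h₂ h₃ h₄).Pins 8 (6 / 5) ∧ (S.reforce g h₁ h₂ h₃ h₄).Rigid ∧
            ∃ s₁ : Stage 1 TowerRates.wide (S.reforce g h₁ h₂ h₃ h₄) (Margins.routeG TowerRates.wide) 1,
              s₁.u (S.τ 0) = s₀.u (S.τ 0)) := by
  intro hF
  obtain ⟨δ, hδ0, hδ⟩ := stageOne_energy_floor
  have hY0 : 0 < TowerRates.wide.Y 0 := TowerRates.Y_pos _ 0
  have hV := TinyBlob.unitBallVol_nonneg
  have hκ₁ := TinyBlob.strainConst_pos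
  -- the scale: `a ≤ 5/256`, `a ≤ κ₁/256`, `2a ≤ δ`, `8 a (|B̄₁| + 1) Y₀² ≤ δ²`
  set a : ℝ := min (min (5 / 256) (TinyBlob.strainConst / 256))
    (min (δ / 2) (δ ^ 2 / (8 * (TinyBlob.unitBallVol + 1) * TowerRates.wide.Y 0 ^ 2))) with ha_def
  have ha : 0 < a :=
    lt_min (lt_min (by norm_num) (by positivity)) (lt_min (by positivity) (by positivity))
  have h5 : a ≤ 5 / 256 := (min_le_left _ _).trans (min_le_left _ _)
  have hκ : a ≤ TinyBlob.strainConst / 256 := (min_le_left _ _).trans (min_le_right _ _)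
  have haδ : a ≤ δ / 2 := (min_le_right _ _).trans (min_le_left _ _)
  have haE : a ≤ δ ^ 2 / (8 * (TinyBlob.unitBallVol + 1) * TowerRates.wide.Y 0 ^ 2) :=
    (min_le_right _ _).trans (min_le_right _ _)
  -- the tiny host and the push handed by the placeholder
  obtain ⟨S, hP, hR, hQ, hrad, s₀, hs₀⟩ := (TinyBlob.levelZeroDataWeak ha h5 hκ).exists_host
  obtain ⟨g, h₁, h₂, h₃, h₄, hP', hR', s₁, hs₁⟩ := hF S hP hR hQ s₀
  have hradδ : (S.reforce g h₁ h₂ h₃ h₄).radius ≤ δ := by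
    rw [Schedule.reforce_radius, hrad]; linarith
  -- the energy floor at `τ₀` …
  have hlt := hδ (S.reforce g h₁ h₂ h₃ h₄) (Margins.routeG TowerRates.wide) hP' hR' hradδ s₁
  -- … is violated by the tiny host
  have hu0 : s₁.u (S.τ 0) = TinyBlob.tinyProfile a := hs₁.trans hs₀
  have hsmall : TowerRates.wide.Y 0 * Real.sqrt ((2 * a) ^ 3 * TinyBlob.unitBallVol) ≤ δ := by
    have hx : TowerRates.wide.Y 0 ^ 2 * ((2 * a) ^ 3 * TinyBlob.unitBallVol) ≤ δ ^ 2 := by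
      have h3 : a ^ 3 ≤ a :=
        calc a ^ 3 = a * a ^ 2 := by ring
          _ ≤ a * 1 := mul_le_mul_of_nonneg_left (by nlinarith) ha.le
          _ = a := mul_one a
      rw [le_div_iff₀ (by positivity)] at haE
      calc TowerRates.wide.Y 0 ^ 2 * ((2 * a) ^ 3 * TinyBlob.unitBallVol)
          = 8 * a ^ 3 * TinyBlob.unitBallVol * TowerRates.wide.Y 0 ^ 2 := by ring
        _ ≤ 8 * a * (TinyBlob.unitBallVol + 1) * TowerRates.wide.Y 0 ^ 2 := by
            have hV1 : TinyBlob.unitBallVol ≤ TinyBlob.unitBallVol + 1 := by linarith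
            gcongr
        _ = a * (8 * (TinyBlob.unitBallVol + 1) * TowerRates.wide.Y 0 ^ 2) := by ring
        _ ≤ δ ^ 2 := haE
    calc TowerRates.wide.Y 0 * Real.sqrt ((2 * a) ^ 3 * TinyBlob.unitBallVol)
        = Real.sqrt (TowerRates.wide.Y 0 ^ 2 * ((2 * a) ^ 3 * TinyBlob.unitBallVol)) := by
          rw [Real.sqrt_mul (sq_nonneg _), Real.sqrt_sq hY0.le]
      _ ≤ Real.sqrt (δ ^ 2) := Real.sqrt_le_sqrt hx
      _ = δ := Real.sqrt_sq hδ0.le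
  have hle : eLpNorm (s₁.u (S.τ 0)) 2 volume ≤ ENNReal.ofReal δ := by
    rw [hu0]
    refine (eLpNorm_two_le_of_bound_of_confined (ρ := 2 * a) (by positivity)
      (TinyBlob.norm_tinyProfile_le ha.ne')
      (fun y hy => TinyBlob.tinyProfile_eq_zero_of_norm_gt ha hy)).trans ?_
    exact ENNReal.ofReal_le_ofReal hsmall
  have hlt' : ENNReal.ofReal δ < eLpNorm (s₁.u (S.τ 0)) 2 volume := by
    simpa only [Schedule.reforce_τ] using hlt
  exact absurd hle (not_le.2 hlt')

/-! ## §3 The registered line's stub statement, by its literal body -/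

/-- **The velocity-only re-forcing placeholder is false** — verbatim the body of the registered stub's
statement `BirthEpisodeBaseG.FirstEpisodeR` of `Cruxes/EpisodeBase/Lines/birth.lean` (844b516; the
`abbrev mG` unfolded to `Margins.routeG TowerRates.wide`): for every pinned rigid quiet wide schedule and
every registered level-`0` host, some admissible re-forcing equal to `S.f` on `[0, τ 0]` is again pinned,
rigid and quiet and carries a level-`1` stage agreeing with the host IN VELOCITY on `[0, τ 0]`. An instance
of `not_firstEpisodeR_noAgree`. [cite: Tao2011, Lemma 8.1 (arXiv Lemma 44)] -/
theorem not_firstEpisodeR_velocityAgree :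
    ¬ (∀ S : Schedule TowerRates.wide, S.Pins 8 (6 / 5) → S.Rigid → S.Quiet →
        ∀ s₀ : Stage 1 TowerRates.wide S (Margins.routeG TowerRates.wide) 0,
          ∃ (g : ℝ → EuclideanSpace ℝ (Fin 3) → EuclideanSpace ℝ (Fin 3))
            (h₁ : IsSmoothOnHalfSpace g) (h₂ : HasRapidSpaceTimeDecay g)
            (h₃ : ∀ t, S.T ≤ t → ∀ x, g t x = 0)
            (h₄ : ∀ k, ∀ t ∈ Icc (S.τ k) (S.τ (k + 1)), ∀ x, ‖g t x‖ ≤ S.c₄ * TowerRates.wide.Y k),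
            (∀ t ∈ Icc 0 (S.τ 0), ∀ x, g t x = S.f t x) ∧
            (S.reforce g h₁ h₂ h₃ h₄).Pins 8 (6 / 5) ∧ (S.reforce g h₁ h₂ h₃ h₄).Rigid ∧
            (S.reforce g h₁ h₂ h₃ h₄).Quiet ∧
            ∃ s₁ : Stage 1 TowerRates.wide (S.reforce g h₁ h₂ h₃ h₄) (Margins.routeG TowerRates.wide) 1,
              ∀ t ∈ Icc 0 (S.τ 0), s₁.u t = s₀.u t) := by
  intro hF
  refine not_firstEpisodeR_noAgree fun S hP hR hQ s₀ => ?_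
  obtain ⟨g, h₁, h₂, h₃, h₄, -, hP', hR', -, s₁, hs₁⟩ := hF S hP hR hQ s₀
  exact ⟨g, h₁, h₂, h₃, h₄, hP', hR', s₁, hs₁ (S.τ 0) ⟨(S.τ_pos 0).le, le_rfl⟩⟩

end Summit.NavierStokesRegularity.EpisodeBaseNegative

end
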